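import Summits.NavierStokesRegularity.OSWSelfSimilar.SheetRPerturbedResolventC
import Summits.NavierStokesRegularity.OSWSelfSimilar.SheetRPerturbedResolventBounds
import HarnessLib

/-!
# SHEET-ℝ frame, (P1) for the FULL operator `A = (−∂² + d∂ + V) + K` under a Gårding datum with a GENERAL `‖v₁‖²_w`-coefficient `c > 0`:
# the first RESOLVENT IDENTITY for `R_K(σ)`, the pseudo-resolvent structure and holomorphy on `Re σ > −m`, and the SHARP pivot bound
# `‖R_K(σ)G‖ ≤ ‖G‖/(m + Re σ)` (cert-1's `‖𝒜(σ)⁻¹J‖_{w→w} ≤ 1/c_w(σ)` for `A_F = B_λ − P + F`, fed by (S1) verbatim)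

HONEST FRAMING (cell ns-blowup GROUP B / zone Z3, case Z3-SR-SPEC, PAPER item (P1) and the analyticity clause of SHEET-R-SPEC-PRICE-impl1 §0 (iii);
1-D MODEL certificate frame (viscous gCLM/OSW sheet on the line); not Euler/NS; «violates: none — MODEL»). Nothing here asserts that a profile
exists; the Gårding datum of the perturbed form ((S1), interval arithmetic) is the HYPOTHESIS `GardingDataKC` of `SheetRPerturbedResolventC`
(`‖v₁‖²_w`-coefficient `c > 0`, closing the typed-interface gap (g1) of STATUS l.7964); `K : Esp L hL →L[ℝ] W L` is arbitrary bounded.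

Verbatim the arguments of `SheetRPerturbedResolventIdentity` and `SheetRPerturbedResolventBounds` §3 on the general datum (the structure-free
inputs `pair_pivot_le_of_weakK`, `reW_imW_add_smul_ae`, `sqrt_mul_add_sqrt_mul_le`, `IsPseudoResolvent.differentiableOn` are REUSED):
`linForm_shiftKC`; `resolventKC_absorb`; **`resolventKC_sub`** (`R_K(z) − R_K(w) = (w − z)R_K(z)R_K(w)`);
**`isPseudoResolventKC : IsPseudoResolvent {Re σ > −m} (resolventKC hL K h)`**; `differentiableOn_resolventKC`; `resolventKC_comm`;
`pivot_coerciveKC_shift` (`(m + s)‖v‖²_w ≤` shifted perturbed form — the `c·‖v₁‖²_w` term is simply dropped, so NO condition on `c` beyond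
`c > 0` enters) and **`norm_resolventKC_le_inv`: `‖resolventKC σ G‖ ≤ ‖G‖/(m + Re σ)` on `Re σ > −m`** — with `m := c₁ + γ` this is the S2 step
rule's constant `1/(c₁ + γ + Re σ)` exactly, independent of `c₂`.
Pure functional analysis; no definition, no named fact.  WHAT THIS IS NOT: not NS; not the spectral certificate; no number of record moves.
-/

noncomputable section

namespace Summit.NavierStokesRegularity.OSWSelfSimilar
namespace SheetRPerturbedResolventIdentityC

open _root_.MeasureTheory _root_.Set _root_.Filter _root_.Real SheetRWeakProfilePV SheetRWeakToStrong SheetREnergyClass SheetRWeightedMeasure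
  SheetRLinearisedTests SheetREnergySpace SheetRTestSpace SheetRLinearisedFormBounds SheetRSolutionOperator SheetRLinearisedCutoffEstimates
  SheetRLinearisedCutoffEnergy SheetRLinearisedUniqueness SheetRResolventPair SheetRComplexPivot SheetRResolventComplex SheetRResolventIdentity
  SheetRResolventBounds SheetRCutoffApproximation SheetRPerturbedUniqueness SheetRPerturbedPair SheetRPerturbedResolventBounds
  SheetRPerturbedResolventC Literature.Analysis.OperatorTheory
open scoped Topology ENNReal

/-! ### §1 The resolvent identity, pseudo-resolvent structure and holomorphy -/

variable {L D₀ D₁ V₀ c m : ℝ} {d V : ℝ → ℝ}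

/-- **Shift of the potential** (coefficient data from `GardingDataK`): for an energy-class profile and a compactly supported test,
`linForm L d (V + s) u u₁ φ φ₁ = linForm L d V u u₁ φ φ₁ + s·∫ w u φ`. [folklore] -/
theorem linForm_shiftKC {hL : 0 < L} {K : Esp L hL →L[ℝ] W L} (h : GardingDataKC L hL d V K D₀ D₁ V₀ c m) (s : ℝ) {u u₁ φ φ₁ : ℝ → ℝ}
    (hφ : IsCompactTest φ φ₁) (hum : AEStronglyMeasurable u volume) (hu₁m : AEStronglyMeasurable u₁ volume)
    (h0 : Integrable fun y => (L ^ 2 + y ^ 2) * u y ^ 2) (h1 : Integrable fun y => (L ^ 2 + y ^ 2) * u₁ y ^ 2) :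
    Integrable (fun y => (L ^ 2 + y ^ 2) * (u y * φ y)) ∧
      linForm L d (fun ξ => V ξ + s) u u₁ φ φ₁ = linForm L d V u u₁ φ φ₁ + s * ∫ y, (L ^ 2 + y ^ 2) * (u y * φ y) := by
  obtain ⟨hint, -⟩ := abs_linForm_le hL h.d_meas h.V_meas h.D₁_nonneg h.d_le h.V_le hφ hum hu₁m h0 h1
  obtain ⟨hc, -, -, -⟩ := basic_of_isCompactTest hφ
  have hwφ := (weighted_of_isCompactTest (L := L) hφ).1
  obtain ⟨hi, -⟩ := integral_weight_abs_mul_le (L := L) hum hc.aestronglyMeasurable h0 hwφ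
  have huφ : Integrable (fun y => (L ^ 2 + y ^ 2) * (u y * φ y)) := by
    refine hi.mono' ((by fun_prop : AEStronglyMeasurable (fun y : ℝ => L ^ 2 + y ^ 2) volume).mul
      (hum.mul hc.aestronglyMeasurable)) (Eventually.of_forall fun y => ?_)
    rw [Real.norm_eq_abs, abs_mul, abs_of_nonneg (by positivity : (0:ℝ) ≤ L ^ 2 + y ^ 2)]
  refine ⟨huφ, ?_⟩
  unfold linForm
  rw [← integral_const_mul, ← integral_add hint (huφ.const_mul s)]
  refine integral_congr_ae (Eventually.of_forall fun y => ?_)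
  ring

/-- **Absorption** for the perturbed resolvent: `R_K(z)(G + (z − w)R_K(w)G) = R_K(w)G` for `z, w` in the half-plane. [folklore] -/
theorem resolventKC_absorb (hL : 0 < L) (K : Esp L hL →L[ℝ] W L) (h : GardingDataKC L hL d V K D₀ D₁ V₀ c m) {z w : ℂ}
    (hz : -m < z.re) (hw : -m < w.re) (G : Wc L) :
    resolventKC hL K h z (G + (z - w) • resolventKC hL K h w G) = resolventKC hL K h w G := by
  set Φ := resolventKC hL K h w G with hΦ
  obtain ⟨happw, hre, him, hweakw⟩ := resolventKC_weak hL K h hw G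
  set P := pairOpKC hL K h w hw (toPair L G) with hP
  have hsolves : ∀ v v₁ : ℝ → ℝ, IsCompactTest v v₁ →
      linForm L d (fun ξ => V ξ + z.re) (prim (der P.fst)) (der P.fst) v v₁
            + (∫ y, (L ^ 2 + y ^ 2) * (((K P.fst : W L) : ℝ → ℝ) y * v y))
            - z.im * ∫ y, (L ^ 2 + y ^ 2) * (prim (der P.snd) y * v y) =
          ∫ y, (L ^ 2 + y ^ 2) * ((((toPair L (G + (z - w) • Φ)).fst : W L) : ℝ → ℝ) y * v y) ∧
        linForm L d (fun ξ => V ξ + z.re) (prim (der P.snd)) (der P.snd) v v₁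
            + (∫ y, (L ^ 2 + y ^ 2) * (((K P.snd : W L) : ℝ → ℝ) y * v y))
            + z.im * ∫ y, (L ^ 2 + y ^ 2) * (prim (der P.fst) y * v y) =
          ∫ y, (L ^ 2 + y ^ 2) * ((((toPair L (G + (z - w) • Φ)).snd : W L) : ℝ → ℝ) y * v y) := by
    intro v v₁ hv
    obtain ⟨e1, e2⟩ := hweakw v v₁ hv
    obtain ⟨humR, hu₁mR, h0R, h1R, -, -⟩ := profile_facts hL P.fst
    obtain ⟨humI, hu₁mI, h0I, h1I, -, -⟩ := profile_facts hL P.snd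
    obtain ⟨hiR, hzR⟩ := linForm_shiftKC h z.re hv humR hu₁mR h0R h1R
    obtain ⟨-, hwR⟩ := linForm_shiftKC h w.re hv humR hu₁mR h0R h1R
    obtain ⟨hiI, hzI⟩ := linForm_shiftKC h z.re hv humI hu₁mI h0I h1I
    obtain ⟨-, hwI⟩ := linForm_shiftKC h w.re hv humI hu₁mI h0I h1I
    obtain ⟨hdre, hdim⟩ := reW_imW_add_smul_ae hL G Φ (z - w)
    obtain ⟨htf, hts⟩ := toPair_fst_snd (G + (z - w) • Φ)
    have hiG1 := integrable_weight_mul_test hL (reW L G) hv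
    have hiG2 := integrable_weight_mul_test hL (imW L G) hv
    have hdat1 : ∫ y, (L ^ 2 + y ^ 2) * ((((toPair L (G + (z - w) • Φ)).fst : W L) : ℝ → ℝ) y * v y) =
        (∫ y, (L ^ 2 + y ^ 2) * (((reW L G : W L) : ℝ → ℝ) y * v y))
          + (z - w).re * (∫ y, (L ^ 2 + y ^ 2) * (prim (der P.fst) y * v y))
          - (z - w).im * ∫ y, (L ^ 2 + y ^ 2) * (prim (der P.snd) y * v y) := by
      have e : ∫ y, (L ^ 2 + y ^ 2) * ((((toPair L (G + (z - w) • Φ)).fst : W L) : ℝ → ℝ) y * v y) =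
          ∫ y, ((L ^ 2 + y ^ 2) * (((reW L G : W L) : ℝ → ℝ) y * v y)
            + (z - w).re * ((L ^ 2 + y ^ 2) * (prim (der P.fst) y * v y))
            - (z - w).im * ((L ^ 2 + y ^ 2) * (prim (der P.snd) y * v y))) := by
        rw [htf]
        refine integral_congr_ae ?_
        filter_upwards [hdre, hre, him] with y hy hyr hyi
        rw [hy, hyr, hyi]; ring
      have hI12 : Integrable (fun y => (L ^ 2 + y ^ 2) * (((reW L G : W L) : ℝ → ℝ) y * v y)
          + (z - w).re * ((L ^ 2 + y ^ 2) * (prim (der P.fst) y * v y))) := hiG1.add (hiR.const_mul _)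
      rw [e, integral_sub hI12 (hiI.const_mul _), integral_add hiG1 (hiR.const_mul _), integral_const_mul, integral_const_mul]
    have hdat2 : ∫ y, (L ^ 2 + y ^ 2) * ((((toPair L (G + (z - w) • Φ)).snd : W L) : ℝ → ℝ) y * v y) =
        (∫ y, (L ^ 2 + y ^ 2) * (((imW L G : W L) : ℝ → ℝ) y * v y))
          + (z - w).re * (∫ y, (L ^ 2 + y ^ 2) * (prim (der P.snd) y * v y))
          + (z - w).im * ∫ y, (L ^ 2 + y ^ 2) * (prim (der P.fst) y * v y) := by
      have e : ∫ y, (L ^ 2 + y ^ 2) * ((((toPair L (G + (z - w) • Φ)).snd : W L) : ℝ → ℝ) y * v y) =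
          ∫ y, ((L ^ 2 + y ^ 2) * (((imW L G : W L) : ℝ → ℝ) y * v y)
            + (z - w).re * ((L ^ 2 + y ^ 2) * (prim (der P.snd) y * v y))
            + (z - w).im * ((L ^ 2 + y ^ 2) * (prim (der P.fst) y * v y))) := by
        rw [hts]
        refine integral_congr_ae ?_
        filter_upwards [hdim, hre, him] with y hy hyr hyi
        rw [hy, hyr, hyi]; ring
      have hI12 : Integrable (fun y => (L ^ 2 + y ^ 2) * (((imW L G : W L) : ℝ → ℝ) y * v y)
          + (z - w).re * ((L ^ 2 + y ^ 2) * (prim (der P.snd) y * v y))) := hiG2.add (hiI.const_mul _)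
      rw [e, integral_add hI12 (hiR.const_mul _), integral_add hiG2 (hiI.const_mul _), integral_const_mul, integral_const_mul]
    rw [hdat1, hdat2, hzR, hzI, Complex.sub_re, Complex.sub_im]
    rw [hwR] at e1
    rw [hwI] at e2
    constructor
    · linarith
    · linarith
  have huniq := pairOpKC_unique hL K h z hz (toPair L (G + (z - w) • Φ)) hsolves
  obtain ⟨happz, -, -, -⟩ := resolventKC_weak hL K h hz (G + (z - w) • Φ)
  rw [happz, ← huniq, ← happw]

/-- **First resolvent identity** for the perturbed resolvent. [folklore] -/
theorem resolventKC_sub (hL : 0 < L) (K : Esp L hL →L[ℝ] W L) (h : GardingDataKC L hL d V K D₀ D₁ V₀ c m) {z w : ℂ}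
    (hz : -m < z.re) (hw : -m < w.re) (G : Wc L) :
    resolventKC hL K h z G - resolventKC hL K h w G = (w - z) • resolventKC hL K h z (resolventKC hL K h w G) := by
  have hab := resolventKC_absorb hL K h hz hw G
  rw [map_add, map_smul] at hab
  have h1 : resolventKC hL K h z G = resolventKC hL K h w G - (z - w) • resolventKC hL K h z (resolventKC hL K h w G) :=
    eq_sub_of_add_eq hab
  rw [h1, ← neg_sub z w, neg_smul]
  abel

/-- **`σ ↦ R_K(σ)` is a pseudo-resolvent on `{Re σ > −m}`** (Kato VIII-§1.1 (1.2)). [folklore] -/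
theorem isPseudoResolventKC (hL : 0 < L) (K : Esp L hL →L[ℝ] W L) (h : GardingDataKC L hL d V K D₀ D₁ V₀ c m) :
    IsPseudoResolvent {σ : ℂ | -m < σ.re} (resolventKC hL K h) := by
  intro z hz w hw
  refine ContinuousLinearMap.ext fun G => ?_
  show resolventKC hL K h z G - resolventKC hL K h w G = (w - z) • resolventKC hL K h z (resolventKC hL K h w G)
  exact resolventKC_sub hL K h hz hw G

/-- **Holomorphy** of `σ ↦ R_K(σ)` on the half-plane `{Re σ > −m}`. [folklore] -/
theorem differentiableOn_resolventKC (hL : 0 < L) (K : Esp L hL →L[ℝ] W L) (h : GardingDataKC L hL d V K D₀ D₁ V₀ c m) :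
    DifferentiableOn ℂ (resolventKC hL K h) {σ : ℂ | -m < σ.re} :=
  (isPseudoResolventKC hL K h).differentiableOn (isOpen_halfPlane m)

/-- The values of the perturbed resolvent commute. [folklore] -/
theorem resolventKC_comm (hL : 0 < L) (K : Esp L hL →L[ℝ] W L) (h : GardingDataKC L hL d V K D₀ D₁ V₀ c m) {z w : ℂ}
    (hz : -m < z.re) (hw : -m < w.re) : resolventKC hL K h z * resolventKC hL K h w = resolventKC hL K h w * resolventKC hL K h z :=
  (isPseudoResolventKC hL K h).comm hz hw


/-! ### §2 The sharp pivot bound for the perturbed complex resolvent -/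

/-- **Pivot coercivity of the shifted perturbed form**: `(m + s)‖v‖²_w ≤ linForm L d (V + s) v v₁ v v₁ + ∫ w K(jmap v)·v`. [folklore] -/
theorem pivot_coerciveKC_shift {hL : 0 < L} {K : Esp L hL →L[ℝ] W L} (h : GardingDataKC L hL d V K D₀ D₁ V₀ c m) (s : ℝ) (vp : testSpace) :
    (m + s) * ∫ ξ, (L ^ 2 + ξ ^ 2) * vp.1.1 ξ ^ 2 ≤
      linForm L d (fun ξ => V ξ + s) vp.1.1 vp.1.2 vp.1.1 vp.1.2
        + ∫ y, (L ^ 2 + y ^ 2) * (((K (jmap hL vp) : W L) : ℝ → ℝ) y * vp.1.1 y) := by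
  obtain ⟨hc, -, -, -⟩ := basic_of_isCompactTest vp.2
  obtain ⟨hwv, hwv₁⟩ := weighted_of_isCompactTest (L := L) vp.2
  obtain ⟨hint, -⟩ := abs_linForm_le hL h.d_meas h.V_meas h.D₁_nonneg h.d_le h.V_le vp.2 hc.aestronglyMeasurable vp.2.memLp.1 hwv hwv₁
  have hshift : linForm L d (fun ξ => V ξ + s) vp.1.1 vp.1.2 vp.1.1 vp.1.2 =
      linForm L d V vp.1.1 vp.1.2 vp.1.1 vp.1.2 + s * ∫ y, (L ^ 2 + y ^ 2) * vp.1.1 y ^ 2 := by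
    unfold linForm
    rw [← integral_const_mul, ← integral_add hint (hwv.const_mul s)]
    refine integral_congr_ae (Eventually.of_forall fun y => ?_)
    ring
  rw [hshift]
  have hG := h.garding vp
  have hn1 : 0 ≤ ∫ ξ, (L ^ 2 + ξ ^ 2) * vp.1.2 ξ ^ 2 := integral_nonneg fun y => by positivity
  nlinarith [mul_nonneg h.c_pos.le hn1]

/-- **`‖R_K(σ)G‖ ≤ ‖G‖/(m + Re σ)`** on the half-plane `Re σ > −m`. [folklore] -/
theorem norm_resolventKC_le_inv (hL : 0 < L) (K : Esp L hL →L[ℝ] W L) (h : GardingDataKC L hL d V K D₀ D₁ V₀ c m) {σ : ℂ} (hσ : -m < σ.re)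
    (G : Wc L) : ‖resolventKC hL K h σ G‖ ≤ ‖G‖ / (m + σ.re) := by
  have hc : 0 < m + σ.re := by linarith
  obtain ⟨happ, -, -, hweak⟩ := resolventKC_weak hL K h hσ G
  set P := pairOpKC hL K h σ hσ (toPair L G) with hP
  obtain ⟨hVs, hVb⟩ := shift_hypsKC h σ.re
  obtain ⟨hGf, hGs⟩ := toPair_fst_snd G
  have hpair := pair_pivot_le_of_weakK hL h.d_meas hVs h.D₀_nonneg h.D₁_nonneg h.d_le hVb K hc (pivot_coerciveKC_shift h σ.re)
    (pR := P.fst) (pI := P.snd) (reW L G) (imW L G) σ.im (fun v v₁ hv => (hweak v v₁ hv).1) (fun v v₁ hv => (hweak v v₁ hv).2)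
  set IR : ℝ := ∫ ξ, (L ^ 2 + ξ ^ 2) * prim (der P.fst) ξ ^ 2 with hIR
  set II : ℝ := ∫ ξ, (L ^ 2 + ξ ^ 2) * prim (der P.snd) ξ ^ 2 with hII
  have hIRnn : 0 ≤ IR := integral_nonneg fun ξ => by positivity
  have hIInn : 0 ≤ II := integral_nonneg fun ξ => by positivity
  have hnormR : ‖resolventKC hL K h σ G‖ = Real.sqrt (IR + II) := by
    rw [happ, norm_ofPair]
    obtain ⟨h1, h2⟩ := ιpair_fst_snd hL P
    have hsq : ‖ιpair hL P‖ ^ 2 = IR + II := by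
      rw [WithLp.prod_norm_sq_eq_of_L2, h1, h2, (norm_ιE_le hL P.fst).1, (norm_ιE_le hL P.snd).1, Real.sq_sqrt hIRnn,
        Real.sq_sqrt hIInn]
    rw [← hsq, Real.sqrt_sq (norm_nonneg _)]
  have hnormG : ‖G‖ = Real.sqrt (‖reW L G‖ ^ 2 + ‖imW L G‖ ^ 2) := by
    rw [← norm_toPair G]
    obtain ⟨h1, h2⟩ := toPair_fst_snd G
    have hsq : ‖toPair L G‖ ^ 2 = ‖reW L G‖ ^ 2 + ‖imW L G‖ ^ 2 := by rw [WithLp.prod_norm_sq_eq_of_L2, h1, h2]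
    rw [← hsq, Real.sqrt_sq (norm_nonneg _)]
  have hcs : ‖reW L G‖ * Real.sqrt IR + ‖imW L G‖ * Real.sqrt II ≤ Real.sqrt (‖reW L G‖ ^ 2 + ‖imW L G‖ ^ 2) * Real.sqrt (IR + II) := by
    have := sqrt_mul_add_sqrt_mul_le (sq_nonneg ‖reW L G‖) (sq_nonneg ‖imW L G‖) hIRnn hIInn
    rwa [Real.sqrt_sq (norm_nonneg _), Real.sqrt_sq (norm_nonneg _)] at this
  have hmain : (m + σ.re) * (IR + II) ≤ ‖G‖ * Real.sqrt (IR + II) := by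
    rw [hnormG]; exact hpair.trans hcs
  rw [hnormR, le_div_iff₀ hc]
  rcases (Real.sqrt_nonneg (IR + II)).eq_or_lt with hz | hpos
  · rw [← hz, zero_mul]; exact norm_nonneg _
  · have h2 : (m + σ.re) * Real.sqrt (IR + II) * Real.sqrt (IR + II) ≤ ‖G‖ * Real.sqrt (IR + II) := by
      rw [mul_assoc, Real.mul_self_sqrt (by positivity)]; exact hmain
    have := le_of_mul_le_mul_right h2 hpos
    linarith

end SheetRPerturbedResolventIdentityC
end Summit.NavierStokesRegularity.OSWSelfSimilar

end
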